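import Summits.BirchSwinnertonDyer.Rank1Residual.F1Sign2.TwoSelmerCubicRayClassAtTwo
import HarnessLib.Audit.Tags
import HarnessLib

/-!
# Cell `bsd-f1-sign2` — analytic lens (planner `-an` g21; MEMO-an v1.62-add5, -add7, -add8 = §24.12, §24.14, §24.15):
# «THE MARKED 2-SELMER LAW» — the DICTIONARY (S38j: odd `∏c_p` ⟺ `Δ = ±N·□`; S38k), the Δ > 0 EXACT LAW with the MARKED REAL PLACE
# (S38l / S38m; REF1's co-marked forms S38l′ / S38m′ and the local lemma L180), and the GRAND UNIFIED LAW on the whole odd-local class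
# (carrier `markedQuadraticCharacters`, S38n / S38o / S38p, decider S38q) — file 1 of 2 (statements only; file 2 = `…MarkedTwoSelmerLawAtTwoKernel.lean`)

STATEMENTS ONLY, typer -ty g16 (one file per candidate, statement-only, REF-gated).  Source: -an g21's cumulative sketch
`HOME/MEMO-an-data/g21/an38/lean/Sketch_v62.lean` **b77f8f722526f6c1** (= `Sketch_v61` ff0813bb00db4e44 + l.702–778 = `Sketch_v60` cccd5017856bfb68 +
l.639–700 + l.702–778), blocks l.593–625 (§24.12 `section Dictionary`), l.639–691 (§24.14 `section MarkedRealPlace`) and l.702–770 (§24.15 `section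
GrandUnified`) VERBATIM — decl bodies byte-identical (builder-verified), namespace `…F1Sign2.ANg21` and `open`s as the sketch; continues
`F1Sign2/TwoSelmerCubicRayClassAtTwo.lean` (§24.9/§24.10: `quadraticRayClassCharacters`, S38f…S38i, AN-39), imported — filed as a NEW sibling (not the append
announced there) to keep both files under the style cap.  Contents: §24.12 plain `def`s S38j `OddTamagawaIffDiscIsConductorTimesSquare` (support,
THEOREM-GRADE = Tate's algorithm; first prover target of the dictionary), `OddTamagawaPosDiscIffSameK` and S38k `RootNumberIsInvariantOfTwoDivisionField`
(COROLLARIES — REF1 §180 duty (1): their sorry-free certificates `oddTamagawaPosDiscIffSameK_of_S38j`, `rootNumberInvariant_of_selmerLaws` are landed in the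
Kernel file, so neither is an obligation); §24.14 carrier `quadraticRayClassCharactersArch F 𝔪 S` (plain def) + `@[conjecture]` S38l `TwoSelmerIsMarkedCubicRayClassPosDisc`,
S38m `RootNumberFromMarkedCubicRayClassPosDisc`; REF1 §180's simplification block VERBATIM from `HOME/REF1-data/b180/lean/Probe180.lean` (5539310bf254b81b; ns
`REF1g16e` → `ANg21`): plain `def`s `SingleRealPlaceAddsNoCharacters` (L180 = R180c, THEOREM-GRADE support), S38l′ `TwoSelmerIsCoMarkedRayClassPosDisc`,
S38m′ `RootNumberFromCoMarkedRayClassPosDisc` (EQUIVALENT forms of S38l/S38m modulo L180 — kernel glue `marked_iff_coMarked` / `markedRoot_iff_coMarkedRoot`, Kernel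
file — NOT separate obligations, REF1 duty (3)); §24.15 carrier `markedQuadraticCharacters F θ S` (plain def) + `@[conjecture]` S38n `TwoSelmerIsMarkedTwoDivisionFieldNegDisc`,
S38o `TwoSelmerIsMarkedTwoDivisionFieldPosDisc`, S38p `RootNumberFromMarkedTwoDivisionField`, and the decider S38q `ShaTwoTrivialIffMarkedCountTwoNegDisc` as a PLAIN
`def` (REF1 duty (4): S38q as typed is S38n rewritten — glue `shaTwoDecider_of_grandUnifiedLaw`, Kernel file — not a conjecture row; the ONE deliberate deviation
from the sketch: its `@[conjecture]` attribute is dropped, body byte-identical).  Each docstring = the sketch's VERBATIM + one «REF1-AUDIT §180» sentence + one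
«REF2-PLACEMENT v47 §23/§26/§28» sentence.
THE CELL'S ANSWER SHAPE (MEMO-an §24.15): the «± object at 2» of the descent storey is the MARKING of `ℚ(E[2]) = ℚ(θ)`, `θ = 4e`: at 2 the prime(s) where `θ` is a
unit (= the formal-group 2-torsion point) are UNRAMIFIED for every Kummer class, the others allow conductor exponent ≤ 2 (`𝔠_θ = ∏_{𝔭∣2, θ∈𝔭} 𝔭²`); at ∞ the
leftmost 2-torsion place is positive.  LAW: `Sel₂(E/ℚ) ≅ {α ∈ F₃^×/□ : N(α) ∈ ℚ^{×2}, cond(F₃(√α)/F₃) ∣ 𝔠_θ·∞_{σ₂}∞_{σ₃}}` on {squarefree `N`, odd `∏c_p`,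
`E(ℚ)[2] = 0`}.
CENSUS = BC5 (MEMO-an §24.12–§24.16): S38j dictionary 27 729/27 729 + 62 636/62 636 (squarefree `N < 10⁵`) and REF1 E-side **786 065/786 065** (all Cremona squarefree
`N < 5·10⁵`); S38k ENGINE H7 j326786 12 928/12 928 `ℚ(E[2])`-groups; S38l/S38m ENGINE H8 j326899 **38 441/38 441** (un-marked variants 16 242 / 0); S38n/S38o/S38p
**ENGINE H10 j327031 121 149/121 149 over all fourteen faces** (Δ<0 78 701, Δ>0 42 448); local rule observed directly L2/L2e 26 400/26 400, L3 24 000/24 000; OUT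
OF SAMPLE (§24.16): 36 000/36 000 root numbers on random curves `N ≤ 6·10¹²` (R1 j327312), 3 000/3 000 + 4 000/4 000 UNCONDITIONAL mwrank 2-Selmer ranks (S2d
j327330, S2c j327250) — totals 121 149 Cremona + 10 311 unconditional 2-descents + 36 000 root numbers + 50 400 local images, 0 exceptions.
REF1-AUDIT §180 (2026-08-29T07:10Z, `HOME/REF1-AUDIT-v1.md` 1d98f2cd7579e3af l.3248; evidence `HOME/REF1-data/b180/`: `Probe180.lean` rc 0, 9 goal probes, 12
sorry-free certificates, std axioms) VERDICT verbatim: «**10/10 SURVIVE, 0 killed, 0 not elaborating.** S38j: TRUE, Literature-grade (Tate's algorithm at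
multiplicative primes; E-side 786 065/786 065). `OddTamagawaPosDiscIffSameK`: COROLLARY of S38j (kernel certificate). S38k: COROLLARY of S38f♮ ∧ S38h♮ (kernel
certificate). Both carriers FAITHFUL (`Nat.card = 2^{rk₂ Cl_{𝔪,S}(F)}`; junk only at `𝔪 = ⊤`, certified, excluded by the laws). S38l / S38m: SURVIVE — and on that
frame they are EQUIVALENT in the kernel, modulo one THEOREM-GRADE local lemma (L180), to the shorter S38l′ `#Sel₂(E/ℚ) = #Cl_{𝔮² ∞_{σ₂} ∞_{σ₃}}(F₃)^∨[2]` / S38m′;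
S38n / S38o / S38p: SURVIVE; here -an's inclusion–exclusion form is NECESSARY (co-marked shortcut fails 2 219/4 000 on the F₃-unramified Δ>0 face); S38q:
SURVIVES but is NOT an obligation — as TYPED it is S38n rewritten.»  THEOREM-GRADE RIDERS (§180): R180a NEVER-MIDDLE (the relaxed-at-∞ 2-Selmer group's real line
is `⟨φ₁⟩` or `⟨φ₃⟩`, never the middle point's; Poonen–Rains 2012 Thm 4.13 + the theta group of `𝒪(2O)`: `q_∞(φ_i) = sgn (e_i−e_j)(e_i−e_k)`; 42 448/42 448; REF2
v47 §29: COROLLARY-OF-PRINT — KMR13 Lemma 5.1(ii)/5.2/§7 + PR12 4.10/4.13 + Kramer 1981), R180b the π-LAW for congruent frame pairs (`w(E) = w(E′)` ⟺ the root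
bijection fixes an END root; 13 500/13 500; dead on the unramified face 256/585), R180c = L180; `𝔠_θ` has exactly one θ-unit prime (`e = f = 1`) on every face but
`e = 3`, `= 𝔮²` on the `e = 2` faces (121 149/121 149) — so S38n/S38o RESTRICT LITERALLY to S38f♮/S38l there.
REF2-PLACEMENT v47 §23 (06:39Z) / §26 (166923e862348b66, 06:50Z) / §28 (6873e2dabd7db939, 07:03Z) verbatim core: «S38j = **IN PRINT** (elementary, theorem-grade:
[cite: SilvermanATAEC1994, §IV.9 Step 2, Cor. 9.2 (d)] Tate's algorithm — `c_p = n` split / `c_p ∈ {1,2} ≡ n (mod 2)` non-split at type `I_n`); S38k =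
PRINT-ASSEMBLY modulo ONE local lemma (L𝔮²; [cite: Kramer1981, Prop. 3], BPT (†.iii)); S38l = **VARIANT / SHARPENING** of [cite: BarrerasalazarPacettiTornaria2021,
Lemma 2.4, Def. 2.8 (P_*(E)), Thm. 2.16] at Δ > 0 — the archimedean MARKING (distinguished place = leftmost root; the −1-twist moves it to ṽ₃, Example p. 8 = 37a1 vs
37b1) IS IN PRINT, the EXACTNESS from pinning the condition at 2 to `𝔮²` is NOT (= the single obligation L𝔮²); S38m = S38l + parity [cite: Monsky1996, Thm. 1.5],
corollary; S38n/S38o/S38p = **NOT IN PRINT, conjecture-grade with a THEOREM PATH** = the marked local lemma L₂^mk (a finite 2-adic case analysis per local type of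
(E/ℚ₂, F₃ ⊗ ℚ₂)) + BPT/Kramer bookkeeping + Poitou–Tate; the exact modulus AT 2 `𝔠_E` is NOT IN PRINT — print has only the window `M_{1,2} ⊂ im δ₂ ⊂ M_{2,2}` and
closes it by the ROOT NUMBER ([cite: ChaoLi2018TwoSelmer, Thm. 1.1]; BPT 2.16), never by an intrinsic local rule: [cite: YooYu2022, Def. 1.5, Thm. 1.10, Thm. 1.11
and the remark before Prop. 1.8] «the even primes are exactly the places where M₁ and M₂ differ. In general, however, it is extremely difficult to exactly compute
im(δ_{K_v}) … for an even prime v»; the archimedean factor `∞₂∞₃` IS in print (BPT `P_*(E)`; Yoo–Yu's semi-narrow class group); grade reading VARIANT-to-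
new-combination, the delta = the intrinsic rule at 2; S38q = S38n + 2-parity + GZK + Kummer (as S38i); beyond-print theorem: no; BSD not proved.»
The Literature print input BPT 2021 Thm 2.16 (+ Def 1.6, Hyp 2.1, Def 2.8) is in the tree as `Literature.NumberTheory.EllipticCurves.BPT2021.twoSelmerRank_clStar_bounds`
(`Literature/NumberTheory/EllipticCurves/TwoSelmerRankCubicFieldClassGroup.lean`, p705338) — its `IsPStarIdeal` marking is the same «σ₂(α)σ₃(α) > 0 over the two
non-distinguished embeddings».  BSD is not proved by this file; no item closed; PARTITION unchanged.
-/

namespace Summit.BirchSwinnertonDyer.Rank1Residual.F1Sign2.ANg21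

open Literature.NumberTheory.EllipticCurves Literature.NumberTheory.EllipticCurves.ModularForms UpperHalfPlane
open Literature.NumberTheory.EllipticCurves.Rank1Residual
open Summit.BirchSwinnertonDyer.Rank1Residual.F1Sign2 Summit.BirchSwinnertonDyer.Rank1Residual.F1Sign2.ANg17
open Summit.BirchSwinnertonDyer.Rank1Residual.F1Sign2.ANg18 Summit.BirchSwinnertonDyer.Rank1Residual.F1Sign2.ANg19
open Summit.BirchSwinnertonDyer.Rank1Residual.F1Sign2.ANg20
open scoped Classical

/-! ### §24.12 DICTIONARY (v60): the crux's odd-local hypothesis at squarefree level = the «sameK» slice -/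
section Dictionary
open NumberField

/-- **S38j `OddTamagawaIffDiscIsConductorTimesSquare` (support; ELEMENTARY — Tate's algorithm at multiplicative primes:
`c_p = v_p(Δ)` if split, `c_p = 2 − (v_p(Δ) mod 2)` if non-split; so at squarefree conductor `∏ c_p` is odd iff every bad
prime divides the minimal discriminant to an odd power iff `Δ = ± N · □`).**  Hence on `{N squarefree}` the odd-local class
of `RankOneAtTwoBigImageOddLocal` is exactly the union of the two «sameK» slices `ℚ(√Δ_E) = ℚ(√N)` (= `SameQuadraticResolventAtTwo`,
`Δ > 0`) and `ℚ(√Δ_E) = ℚ(√−N)` (`Δ < 0`): the quadratic resolvent of `ℚ(E[2])` is the genus field of the level, every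
`p ∣ N` decomposes in `F₃` as `𝔮₁𝔮₂²` with residue degrees `1`, and `N` (odd part) is recovered from `F₃` as the product of its
odd ramified primes.  Census (squarefree `N < 10⁵`, odd torsion; H5/H5e meta × allbsd): odd `∏c_p` ⟹ sameK 27729/27729, even
`∏c_p` ⟹ ¬sameK 62636/62636.  Consequence with S38h♮: on the class with `Δ < 0`, the global root number `w(E)` is a function
of the cubic field `ℚ(E[2])` alone (equivalently `∏_{p ∣ N} a_p(E) = (−1)^{T(F₃) + 1 + ω(N)}`). (folklore; Silverman ATAEC IV §9, Tate's algorithm — see the REF2 tag below)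
(support; plain `def` — NOT an obligation of the route.)  REF1-AUDIT §180: **TRUE, Literature-grade / THEOREM-GRADE** (Tate's algorithm at
multiplicative primes: `c_p` odd ⟺ `v_p(Δ)` odd either way; `[IsGloballyMinimal]` IS needed — `Δ` of the model); REF1 E-side exact check on all 786 065
Cremona curves of squarefree `N < 5·10⁵` (`check_s38j180.txt`): odd 128 792 all `|Δ| = N·□`, even 657 273 none, 0 violations; first PROVER TARGET of the
dictionary (inputs: the tree's Tate-algorithm facts `localTamagawaNumber_of_hasNonsplitMultiplicativeReductionAt` & co., `NeronComponentIndex.lean`).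
REF2-PLACEMENT v47 §23.1: **IN PRINT** (elementary) — [cite: SilvermanATAEC1994, §IV.9 Step 2, Cor. 9.2 (d)] («if a fiber of Type `I_n` has non-split reduction,
then it has at most two components defined over `k` … if split …, `n` equals the valuation of the minimal discriminant»); the sketch's own pointer
«Silverman AEC IV §9» means ATAEC IV §9 (Tate's algorithm). -/
def OddTamagawaIffDiscIsConductorTimesSquare : Prop :=
  ∀ (W : WeierstrassCurve ℚ) [W.IsElliptic] [W.IsGloballyMinimal], Squarefree (W.conductorNorm ℤ) →
    (Odd W.tamagawaProduct ↔
      ∃ q : ℚ, q ≠ 0 ∧ (W.Δ = (W.conductorNorm ℤ : ℚ) * q ^ 2 ∨ W.Δ = -(W.conductorNorm ℤ : ℚ) * q ^ 2))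

/-- The `Δ > 0` half of S38j in the tree's own vocabulary: at squarefree level, `Odd ∏c_p ∧ Δ > 0 ↔ SameQuadraticResolventAtTwo`.
REF1-AUDIT §180: **COROLLARY of S38j** — kernel certificate `ANg21.oddTamagawaPosDiscIffSameK_of_S38j` (Kernel file; `−N·q² < 0` and `Δ ≠ 0` via
`isUnit_Δ`); plain `def`, not an obligation (REF1 duty (1)).  REF2 v47 §23.1: in print with S38j. -/
def OddTamagawaPosDiscIffSameK : Prop :=
  ∀ (W : WeierstrassCurve ℚ) [W.IsElliptic] [W.IsGloballyMinimal], Squarefree (W.conductorNorm ℤ) →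
    ((Odd W.tamagawaProduct ∧ 0 < W.Δ) ↔ SameQuadraticResolventAtTwo W)

/-- **S38k `RootNumberIsInvariantOfTwoDivisionField` (COROLLARY-CANDIDATE of S38h♮ + finiteness of ray class groups):** two curves of
the class (`N`, `N'` squarefree, odd `∏c_p`, `Δ, Δ' < 0`, `E[2](ℚ) = E'[2](ℚ) = 0`) with a common cubic `2`-division field ramified at `2`
have the same global root number.  A statement with NO ray-class vocabulary — falsifiable by one pair (0 pairs differ among the 70269
`Δ < 0` rows of ENGINE H6, where 2-division fields are shared across conductors only rarely; the law `w = (−1)^T` implies it).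
(plain `def`; COROLLARY, not an obligation.)  REF1-AUDIT §180: **COROLLARY of S38f♮ ∧ S38h♮** — kernel certificate
`ANg21.rootNumberInvariant_of_selmerLaws` (Kernel file; its «`#Sel₂` is a power of 2» input is discharged there by `exists_natCard_selmerGroup_two_eq_pow`), and of
S38h♮ + finiteness of the ray-class character set (-an's `rootNumberInvariant_of_rootNumberLaw`, Kernel file, hypothesis `hfin` TRUE incl. junk but not yet a
tree lemma); typing faithful (on the frame `F` is an `S₃`-cubic, so «common `F` up to isomorphism» is the right notion); = the Δ<0 pair-consequence REF1's
§179 third engine tested (12 540/12 540).  REF2-PLACEMENT v47 §23.2: **PRINT-ASSEMBLY modulo ONE local lemma** (L𝔮²): within a `ℚ(E[2])`-group on the class the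
Selmer structure is module-determined at every place — [cite: Kramer1981, Prop. 3] at multiplicative primes with `v_p(Δ)` odd (= BPT (†.iii)), nothing at `∞`
when `Δ < 0`, and at 2 iff the Kummer image is the `𝔮²`-condition; conjecture-grade as filed, print-assembly the moment L𝔮² is a theorem; beyond-print theorem: no. -/
def RootNumberIsInvariantOfTwoDivisionField : Prop :=
  ∀ (W W' : WeierstrassCurve ℚ) [W.IsElliptic] [W.IsGloballyMinimal] [W'.IsElliptic] [W'.IsGloballyMinimal],
    Squarefree (W.conductorNorm ℤ) → Squarefree (W'.conductorNorm ℤ) → Odd W.tamagawaProduct → Odd W'.tamagawaProduct →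
    W.Δ < 0 → W'.Δ < 0 → NoRationalTwoTorsion W → NoRationalTwoTorsion W' →
    ∀ (F : Type) [Field F] [NumberField F], IsCubicTwoDivisionField W F → IsCubicTwoDivisionField W' F →
    (∃ Q : Ideal (𝓞 F), Q.IsPrime ∧ (2 : 𝓞 F) ∈ Q ^ 2) → W.rootNumber = W'.rootNumber

end Dictionary

/-! ### §24.14 (v61) THE Δ>0 EXACT LAW: the free bit is the MARKED REAL PLACE of `ℚ(E[2])` (the place of the leftmost 2-torsion point) -/
section MarkedRealPlace
open NumberField

/-- Quadratic characters of the ray class group of `F` modulo `𝔪 · ∏_{σ ∈ S} ∞_σ` (archimedean part = the set `S` of real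
embeddings): as `quadraticRayClassCharacters`, but the ray is `a ≡ 1 (mod 𝔪)` AND `σ a > 0` for all `σ ∈ S`.
`Nat.card` of this set is `2^{rk₂ Cl_{𝔪 S}(F)}`.  (`S = ∅` recovers `quadraticRayClassCharacters F 𝔪`.)
REF1-AUDIT §180 A2: **FAITHFUL** — `= Hom(Cl_{𝔪,S}(F), ±1)` for `⊥ < 𝔪 < ⊤` (the killed principal ideals are exactly `P_{𝔪,S}`; every class has an integral
representative coprime to `𝔪`; §179 argument verbatim), so `Nat.card = 2^{rk₂ Cl_{𝔪,S}(F)}`; `S = ∅` recovers `quadraticRayClassCharacters` (kernel lemma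
`ANg21.quadraticRayClassCharactersArch_empty`); **junk at `𝔪 = ⊤`: `= {1}` for every `S`** (certificate `ANg21.quadraticRayClassCharactersArch_top`, Kernel file),
excluded by the laws' `Q.IsPrime ∧ 2 ∈ Q ^ 2`.  REF2 v47 §26/§28: the archimedean part of the modulus is IN PRINT — BPT 2021's `P_*(E)` / `Cl_*(A_K,E)`
[cite: BarrerasalazarPacettiTornaria2021, Def. 2.8] and Yoo–Yu's semi-narrow class group [cite: YooYu2022, Def. 1.5] (tree: `BPT2021.clStarQuadraticCharacters`). -/
def quadraticRayClassCharactersArch (F : Type) [Field F] [NumberField F] (m : Ideal (𝓞 F)) (S : Set (F →+* ℝ)) :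
    Set (Ideal (𝓞 F) → ℤˣ) :=
  {χ | (∀ I J : Ideal (𝓞 F), I ⊔ m = ⊤ → J ⊔ m = ⊤ → χ (I * J) = χ I * χ J) ∧
       (∀ I : Ideal (𝓞 F), I ⊔ m ≠ ⊤ → χ I = 1) ∧
       (∀ a : 𝓞 F, a ≠ 0 → a - 1 ∈ m → (∀ σ ∈ S, 0 < σ (a : F)) → χ (Ideal.span {a}) = 1)}

/-- **S38l `TwoSelmerIsMarkedCubicRayClassPosDisc` (CANDIDATE LAW, Δ > 0; ENGINE H8 j326899: 38441/38441 on all squarefree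
`N < 5·10⁵` with odd torsion, odd `∏c_p`, `F₃` ramified at 2; the un-marked variants fail: 16242/38441 and 0/38441).**
Frame as S38f♮ but `Δ > 0` (so `F₃ = ℚ(E[2])` is totally real with three real embeddings `σ₁, σ₂, σ₃`, and `σ ↦ σ(x₁)`, `x₁ ∈ F₃`
the root of the 2-division cubic, is a bijection onto the three real 2-torsion abscissae `e₁ < e₂ < e₃`).  MARK `σ₁` := the
embedding with `σ₁(x₁)` smallest (the left end of the egg).  Then, with `A = Cl_{𝔮²}`, `B_S = Cl_{𝔮²·∏_{σ∈S}∞_σ}` and `#(·)` the number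
of quadratic characters:  **`#Sel₂(E/ℚ) = 2·#A^∨[2] + #B_{σ₂σ₃}^∨[2] − #B_{σ₂}^∨[2] − #B_{σ₃}^∨[2]`**, i.e. `Sel₂(E)` ≅ the quadratic
characters of conductor dividing `𝔮² ∞_{σ₂} ∞_{σ₃}` whose ramification at `∞_{σ₂}` and at `∞_{σ₃}` AGREE (the Kummer image of
`E(ℝ)/2E(ℝ) ≅ ℤ/2` is `{(+,+,+), (+,−,−)}` in the sign space at `(σ₁, σ₂, σ₃)`).  Stated additively to avoid truncated subtraction.
Why it might fail: as S38f♮ (local lemma L𝔮² at 2), plus the archimedean identification; it is exact on the whole Cremona range.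
REF1-AUDIT §180: **SURVIVES**; frame/marking audited A2 (`σ₁ x₁ < σ₂ x₁, σ₃ x₁` = «σ₁ is the place where `x₁` is SMALLEST», symmetric in `σ₂ σ₃` —
`ANg21.markedCount_symm`; the three `σ_i x₁` are the three real roots, so the hypotheses pin `(σ₁; {σ₂,σ₃})` uniquely and are satisfiable; 37a1/37b1 inhabit
both values of the free bit); on this ramified frame **EQUIVALENT in the kernel, modulo the theorem-grade local lemma L180 `SingleRealPlaceAddsNoCharacters`, to
S38l′ `TwoSelmerIsCoMarkedRayClassPosDisc` (`#Sel₂ = #Cl_{𝔮²∞_{σ₂}∞_{σ₃}}(F₃)^∨[2]`)** (`ANg21.marked_iff_coMarked`; the `A`, `B_{σ₂}`, `B_{σ₃}` terms cancel: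
-an H8 `m1 = m2 = m4 = m0` 38 441/38 441); S38l′ DIRECT vs Cremona 38 335/38 335 + 106 `16∣Ш_an`-ambiguous consistent; R180a NEVER-MIDDLE: the jumping pair
is `{σ₂,σ₃}` or `{σ₁,σ₂}`, never `{σ₁,σ₃}` (H8 mask 5: 0/38 441).  REF2-PLACEMENT v47 §26: **VARIANT / SHARPENING of [cite: BarrerasalazarPacettiTornaria2021,
Lemma 2.4, Def. 2.8 (P_*(E)), Thm. 2.16] at Δ > 0** — the archimedean MARKING (distinguished place = leftmost root's; the Kummer image of `E(ℝ)/2E(ℝ)` is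
`{(+,+,+),(+,−,−)}`; the `−1`-twist moves it to `ṽ₃`, BPT Example p. 8 = 37a1 vs 37b1) IS IN PRINT and `𝔮²∞_{σ₂}∞_{σ₃}` IS BPT's `P_*(E)`-condition; NOT IN
PRINT = the EXACTNESS from pinning the place-2 condition to `𝔮²` (BPT's slack `[K:ℚ] = 1` lives at 2) — the same single obligation L𝔮² (§19/§20/§23), «exact
at 2 by L𝔮² (this cell)»; beyond-print theorem: no. -/
@[conjecture] def TwoSelmerIsMarkedCubicRayClassPosDisc : Prop :=
  ∀ (W : WeierstrassCurve ℚ) [W.IsElliptic] [W.IsGloballyMinimal],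
    Squarefree (W.conductorNorm ℤ) → Odd W.tamagawaProduct → 0 < W.Δ → NoRationalTwoTorsion W →
    ∀ (F : Type) [Field F] [NumberField F], IsCubicTwoDivisionField W F →
    ∀ Q : Ideal (𝓞 F), Q.IsPrime → (2 : 𝓞 F) ∈ Q ^ 2 →
    ∀ (x₁ : F), (W.baseChange F).twoTorsionPolynomial.toPoly.IsRoot x₁ →
    ∀ (σ₁ σ₂ σ₃ : F →+* ℝ), σ₁ ≠ σ₂ → σ₁ ≠ σ₃ → σ₂ ≠ σ₃ → σ₁ x₁ < σ₂ x₁ → σ₁ x₁ < σ₃ x₁ →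
      2 * Nat.card (quadraticRayClassCharactersArch F (Q ^ 2) ∅)
        + Nat.card (quadraticRayClassCharactersArch F (Q ^ 2) {σ₂, σ₃})
      = Nat.card (W.selmerGroup 2)
        + Nat.card (quadraticRayClassCharactersArch F (Q ^ 2) {σ₂})
        + Nat.card (quadraticRayClassCharactersArch F (Q ^ 2) {σ₃})

/-- **S38m `RootNumberFromMarkedCubicRayClassPosDisc` (CANDIDATE, Δ > 0; 38441/38441):** with the same marking,
`w(E) = (−1)^{dim Sel₂}` where `2^{dim Sel₂}` is the right-hand count of S38l — so at `Δ > 0` the global root number is a function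
of `(ℚ(E[2]), marked real place)`; the marking is exactly what distinguishes 37a1 (`w = −1`) from 37b1 (`w = +1`), which share
`ℚ(E[2]) = ℚ[x]/(x³ − x² − 3x + 1)`.
REF1-AUDIT §180: **SURVIVES**; = S38l + 2-Selmer parity (kernel `ANg21.rootNumberLawPos_of_selmerLawPos`, pattern of `rootNumberLaw_of_selmerLaw`);
EQUIVALENT modulo L180 to S38m′ `RootNumberFromCoMarkedRayClassPosDisc` (`ANg21.markedRoot_iff_coMarkedRoot`); S38m′ vs rank parity 38 441/38 441; R180b
π-LAW (E-side, 13 500/13 500 congruent ramified frame pairs): `w(E) = w(E′)` ⟺ the Galois root bijection fixes an END root, else `w` flips and `|Δ dim Sel₂| = 1`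
— dead on the unramified face (256/585), the E-side proof that the 2-adic marking is `θ`-dependent.  REF2-PLACEMENT v47 §26: = S38l + parity
[cite: Monsky1996, Thm. 1.5] [cite: DokchitserDokchitser2010ModSquares, Thm. 1.4] — COROLLARY, conjecture-grade as filed, PRINT-ASSEMBLY once L𝔮² lands (a
class-field formula for the root number at Δ > 0); the marking is exactly what distinguishes 37a1 (`w = −1`) from 37b1 (`w = +1`); beyond-print theorem: no. -/
@[conjecture] def RootNumberFromMarkedCubicRayClassPosDisc : Prop :=
  ∀ (W : WeierstrassCurve ℚ) [W.IsElliptic] [W.IsGloballyMinimal],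
    Squarefree (W.conductorNorm ℤ) → Odd W.tamagawaProduct → 0 < W.Δ → NoRationalTwoTorsion W →
    ∀ (F : Type) [Field F] [NumberField F], IsCubicTwoDivisionField W F →
    ∀ Q : Ideal (𝓞 F), Q.IsPrime → (2 : 𝓞 F) ∈ Q ^ 2 →
    ∀ (x₁ : F), (W.baseChange F).twoTorsionPolynomial.toPoly.IsRoot x₁ →
    ∀ (σ₁ σ₂ σ₃ : F →+* ℝ), σ₁ ≠ σ₂ → σ₁ ≠ σ₃ → σ₂ ≠ σ₃ → σ₁ x₁ < σ₂ x₁ → σ₁ x₁ < σ₃ x₁ →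
    ∀ k : ℕ,
      2 * Nat.card (quadraticRayClassCharactersArch F (Q ^ 2) ∅)
        + Nat.card (quadraticRayClassCharactersArch F (Q ^ 2) {σ₂, σ₃})
      = 2 ^ k
        + Nat.card (quadraticRayClassCharactersArch F (Q ^ 2) {σ₂})
        + Nat.card (quadraticRayClassCharactersArch F (Q ^ 2) {σ₃}) →
      W.rootNumber = (-1) ^ k

end MarkedRealPlace

/-! ### REF1 §180 simplification of S38l / S38m (riders R180c, L180)
(i) `SingleRealPlaceAddsNoCharacters` — ONE real place in the modulus never adds quadratic characters when the finite part is
`Q²` with `2 ∈ Q²` (so `e(Q|2) ≥ 2`): a quadratic `F(√α)/F` of conductor `∣ Q²·∞_σ` is unramified at every other prime, and at `Q`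
conductor exponent `≤ 2` forces `α ∈ F_Q^{×2}·(1 + 𝔭^{2e−1})`, whence `N_{F_Q/ℚ₂}`-norm `≡ 1 (mod 4)` and `(α,−1)_Q = +1`; Hilbert
reciprocity for `(α, −1)` then makes the number of real places with `σ(α) < 0` EVEN — never exactly one.  [-an H8: m1=m2=m4=m0 on
38441/38441.]  Hence the `B_{σ₂}`, `B_{σ₃}` terms of S38l equal the `A` term and S38l collapses to
(S38l′) `#Sel₂(E/ℚ) = #Cl_{𝔮² ∞_{σ₂} ∞_{σ₃}}(F₃)^∨[2]` — the characters unramified at the MARKED place `σ₁` (where `x₁` is smallest);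
under the Cassels–Schaefer–Stoll embedding `H¹(ℚ,E[2]) ↪ F₃^×/□` this is the group-level identity `Sel₂(E) = {α : σ₁(α) > 0, finite
conditions}` (Kummer image at `∞` = `⟨φ₁⟩ = {(+,+,+),(+,−,−)}`).  DIRECT CHECK `2^{m6} = #Sel₂` vs Cremona: 38335/38335 + 106 ambiguous
consistent (REF1 check_h8_180). -/
section Simplification
open NumberField

/-- (i) / L180: a single real place in the modulus adds no quadratic ray class characters (finite part `Q²`, `2 ∈ Q²`). THEOREM-grade
(local conductor computation + Hilbert reciprocity); -an ENGINE H8: 3 × 38441/38441.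
(REF1 §180 rider R180c = L180, typed by REF1 in `Probe180.lean`, VERBATIM; plain `def` — THEOREM-GRADE support with a one-paragraph proof, not a conjecture
row.)  PROOF (REF1 §180): for `α ∈ F^×` with `cond(F(√α)/F) ∣ Q²·∞_S`, Hilbert reciprocity for `(α, −1)`: at odd `v` and at `v ∣ 2, v ≠ Q` the extension is
unramified so `(α,−1)_v = +1`; at `Q` (`e = e(Q|2) ≥ 2`) Hecke's conductor bound forces `α ∈ F_Q^{×2}·(1 + 𝔭^{2e−1})`, whence `N_{F_Q/ℚ₂}(1 + x) ≡ 1 (mod 4)` and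
`(α,−1)_Q = +1`; so `#{σ real : σ(α) < 0}` is EVEN — never exactly one; hence `Cl_{Q²,{σ}}^∨[2] = Cl_{Q²}^∨[2]`.  SHARP: false with `e(Q|2) = 1` (`α ≡ 3 (mod 4)`),
and indeed single places DO add characters on -an's UNRAMIFIED faces (Δ<0 4 542/8 432, Δ>0 2 941/4 007); on all RAMIFIED faces never (70 269 + 3 × 38 441 rows).
REF2 v47 §29 (context): the real-place bookkeeping is COROLLARY-OF-PRINT ([cite: PoonenRains2012, Prop. 4.10, Thm. 4.13]; [cite: KlagsbrunMazurRubin2013, Lemma 5.1 (ii), Lemma 5.2];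
[cite: Kramer1981, Prop. 3]). -/
def SingleRealPlaceAddsNoCharacters : Prop :=
  ∀ (F : Type) [Field F] [NumberField F] (Q : Ideal (𝓞 F)), Q.IsPrime → (2 : 𝓞 F) ∈ Q ^ 2 →
    ∀ σ : F →+* ℝ, Nat.card (quadraticRayClassCharactersArch F (Q ^ 2) {σ})
      = Nat.card (quadraticRayClassCharactersArch F (Q ^ 2) ∅)

/-- **S38l′ (REF1 §180 simplified marked law):** same frame and marking as S38l; `#Sel₂(E/ℚ) = #Cl_{𝔮²∞_{σ₂}∞_{σ₃}}(F₃)^∨[2]`.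
(REF1 §180's simplified form S38l′, typed by REF1 in `Probe180.lean`, VERBATIM; plain `def` — an EQUIVALENT form of S38l modulo L180 (`ANg21.marked_iff_coMarked`,
Kernel file), NOT a separate obligation; REF1 duty (3).)  Same frame and marking as S38l: `#Sel₂(E/ℚ) = #Cl_{𝔮²∞_{σ₂}∞_{σ₃}}(F₃)^∨[2]` — the characters unramified at
the MARKED place `σ₁`; under the Cassels–Schaefer–Stoll embedding `H¹(ℚ,E[2]) ↪ F₃^×/□` the group-level identity `Sel₂(E) = {α : σ₁(α) > 0, finite conditions}`
(Kummer image at `∞` = `⟨φ₁⟩ = {(+,+,+),(+,−,−)}`) whose only non-printed input is the finite dictionary at 2 (L𝔮²).  REF1 DIRECT CHECK `2^{m6} = #Sel₂` vs Cremona: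
38 335/38 335 + 106 ambiguous consistent (`check_h8_180.txt`).  REF2 v47 §26: = BPT's `P_*(E)`-group made exact at 2 [cite: BarrerasalazarPacettiTornaria2021, Def. 2.8, Thm. 2.16];
beyond-print theorem: no. -/
def TwoSelmerIsCoMarkedRayClassPosDisc : Prop :=
  ∀ (W : WeierstrassCurve ℚ) [W.IsElliptic] [W.IsGloballyMinimal],
    Squarefree (W.conductorNorm ℤ) → Odd W.tamagawaProduct → 0 < W.Δ → NoRationalTwoTorsion W →
    ∀ (F : Type) [Field F] [NumberField F], IsCubicTwoDivisionField W F →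
    ∀ Q : Ideal (𝓞 F), Q.IsPrime → (2 : 𝓞 F) ∈ Q ^ 2 →
    ∀ (x₁ : F), (W.baseChange F).twoTorsionPolynomial.toPoly.IsRoot x₁ →
    ∀ (σ₁ σ₂ σ₃ : F →+* ℝ), σ₁ ≠ σ₂ → σ₁ ≠ σ₃ → σ₂ ≠ σ₃ → σ₁ x₁ < σ₂ x₁ → σ₁ x₁ < σ₃ x₁ →
      Nat.card (W.selmerGroup 2) = Nat.card (quadraticRayClassCharactersArch F (Q ^ 2) {σ₂, σ₃})

/-- **S38m′:** `w(E) = (−1)^k` where `#Cl_{𝔮²∞_{σ₂}∞_{σ₃}}(F₃)^∨[2] = 2^k`. [(−1)^{m6} = (−1)^{rank}: 38441/38441]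
(REF1 §180's S38m′, VERBATIM from `Probe180.lean`; plain `def` — EQUIVALENT to S38m modulo L180 (`ANg21.markedRoot_iff_coMarkedRoot`) and a consequence of
S38l′ + 2-Selmer parity (`ANg21.coMarkedRoot_of_coMarked`); NOT a separate obligation.)  `w(E) = (−1)^k` where `#Cl_{𝔮²∞_{σ₂}∞_{σ₃}}(F₃)^∨[2] = 2^k`.
[(−1)^{m6} = (−1)^{rank}: 38 441/38 441.]  REF2 v47 §26: corollary via [cite: Monsky1996, Thm. 1.5]; beyond-print theorem: no. -/
def RootNumberFromCoMarkedRayClassPosDisc : Prop :=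
  ∀ (W : WeierstrassCurve ℚ) [W.IsElliptic] [W.IsGloballyMinimal],
    Squarefree (W.conductorNorm ℤ) → Odd W.tamagawaProduct → 0 < W.Δ → NoRationalTwoTorsion W →
    ∀ (F : Type) [Field F] [NumberField F], IsCubicTwoDivisionField W F →
    ∀ Q : Ideal (𝓞 F), Q.IsPrime → (2 : 𝓞 F) ∈ Q ^ 2 →
    ∀ (x₁ : F), (W.baseChange F).twoTorsionPolynomial.toPoly.IsRoot x₁ →
    ∀ (σ₁ σ₂ σ₃ : F →+* ℝ), σ₁ ≠ σ₂ → σ₁ ≠ σ₃ → σ₂ ≠ σ₃ → σ₁ x₁ < σ₂ x₁ → σ₁ x₁ < σ₃ x₁ →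
    ∀ k : ℕ, Nat.card (quadraticRayClassCharactersArch F (Q ^ 2) {σ₂, σ₃}) = 2 ^ k → W.rootNumber = (-1) ^ k

end Simplification

/-! ### §24.15 (v62) THE GRAND UNIFIED LAW on the whole odd-local class (ENGINE H10: 121149/121149, every face)
`Sel₂(E/ℚ) ≅ {α ∈ F₃^×/F₃^{×2} : N(α) ∈ ℚ^{×2}, cond(F₃(√α)/F₃) ∣ 𝔠_E · ∞_{σ₂} ∞_{σ₃}}`, where `F₃ = ℚ(E[2]) = ℚ(θ)`, `θ = 4e`,
`𝔠_E = ∏_{𝔭 ∣ 2, θ ∈ 𝔭} 𝔭²` (the primes over 2 at which `θ` is a unit — the 2-torsion point in the FORMAL GROUP at 2 — are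
excluded: the Kummer classes are unramified there), and `σ₁` = the real place of the leftmost 2-torsion point (no condition at `σ₁`
is needed when `Δ < 0`: it is automatic).  The MARKING (formal prime at 2, leftmost place at ∞) is the "± object at 2" of this cell. -/
section GrandUnified
open NumberField

/-- Quadratic characters of `F` of conductor dividing `𝔠_θ · ∏_{σ∈S} ∞_σ`, `𝔠_θ := ∏_{𝔭 ∣ 2, θ ∈ 𝔭} 𝔭²`, written on ideals coprime
to `2` (every ray class has such a representative): multiplicative on ideals coprime to 2, `1` (junk) off them, trivial on principal
ideals `(a)` with `a` coprime to 2, `a ≡ 1 (mod 𝔭²)` for every prime `𝔭 ∣ 2` containing `θ`, and `σ a > 0` for `σ ∈ S`.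
`Nat.card` of this set is `2^{rk₂ Cl_{𝔠_θ S}(F)}`.
REF1-AUDIT §180 A2: **FAITHFUL** — `= Hom(Cl_{𝔠_θ,S}(F), ±1)`, `𝔠_θ = ∏_{P∣2, θ∈P} P²` (the ray conditions at distinct primes combine by CRT; CHANGE OF SUPPORT
to ideals coprime to 2: `I^{(2)}/(P_{𝔠_θ,S} ∩ I^{(2)}) ≅ I^{𝔠_θ}/P_{𝔠_θ,S}`, surjective because every ray class mod `𝔠_θ` has a representative coprime to 2); NO
`⊤`-junk possible (the support is the fixed ideal `(2) ≠ ⊤`); the `θ` binder `∀ θ : 𝓞 F, (θ : F) = 4·x₁ → …` is NON-VACUOUS (`4x₁` is a root of the monic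
`X³ + b₂X² + 8b₄X + 16b₆ ∈ ℤ[X]`) and MODEL-SAFE (a change of minimal model shifts `θ ↦ θ − 4r`, so `{P ∣ 2 : θ ∈ P}` is invariant); **structure of `𝔠_θ`
(REF1 `check_ctheta180.txt`, 121 149/121 149): on every face there is EXACTLY ONE prime over 2 at which `θ` is a unit, with `e = f = 1` (the formal-group
2-torsion point), except the totally ramified face (`e = 3`: all of `E[2]` formal); on the `e = 2` faces `𝔠_θ = 𝔮²`, so S38n/S38o RESTRICT LITERALLY to
S38f♮/S38l there.**  REF2-PLACEMENT v47 §28: the exact modulus AT 2 is **NOT IN PRINT** — print has the window `M_{1,2} ⊂ im δ₂ ⊂ M_{2,2}` [cite: YooYu2022, Def. 1.5,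
Thm. 1.10, Thm. 1.11] («the even primes are exactly the places where `M₁` and `M₂` differ … it is extremely difficult to exactly compute `im(δ_{K_v})` … for an even
prime `v`»), [cite: BarrerasalazarPacettiTornaria2021, Cor. 1.8, Thm. 1.10, Lemma 2.4]; the archimedean factor IS in print (BPT `P_*(E)`). -/
def markedQuadraticCharacters (F : Type) [Field F] [NumberField F] (θ : 𝓞 F) (S : Set (F →+* ℝ)) :
    Set (Ideal (𝓞 F) → ℤˣ) :=
  {χ | (∀ I J : Ideal (𝓞 F), I ⊔ Ideal.span {(2 : 𝓞 F)} = ⊤ → J ⊔ Ideal.span {(2 : 𝓞 F)} = ⊤ → χ (I * J) = χ I * χ J) ∧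
       (∀ I : Ideal (𝓞 F), I ⊔ Ideal.span {(2 : 𝓞 F)} ≠ ⊤ → χ I = 1) ∧
       (∀ a : 𝓞 F, a ≠ 0 → (∀ P : Ideal (𝓞 F), P.IsPrime → (2 : 𝓞 F) ∈ P → a ∉ P) →
          (∀ P : Ideal (𝓞 F), P.IsPrime → (2 : 𝓞 F) ∈ P → θ ∈ P → a - 1 ∈ P ^ 2) →
          (∀ σ ∈ S, 0 < σ (a : F)) → χ (Ideal.span {a}) = 1)}

/-- **S38n `TwoSelmerIsMarkedTwoDivisionFieldNegDisc` (GRAND UNIFIED LAW, `Δ < 0` half; ENGINE H10 j327031: 78701/78701 over all seven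
`Δ < 0` faces — `2 ∣ N` or not, `F₃` ramified at 2 or not).**  `N` squarefree, `∏ c_p` odd, `E[2](ℚ) = 0`, `Δ < 0`, `F = ℚ(E[2])`,
`x₁ ∈ F` the root of the 2-division cubic, `θ = 4x₁ ∈ 𝓞 F`:  `#Sel₂(E/ℚ) = #markedQuadraticCharacters F θ ∅`.
On the faces with `F₃` ramified at 2 this is S38f♮ (`𝔠_θ = 𝔮²`); on the unramified faces it is NEW (`𝔠_θ = (4)·𝔭₀⁻²`, `𝔭₀` the
formal-group prime), where no law in `F₃` alone existed without the marking.  Why it might fail: the local rule at 2 («unramified at the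
primes where `θ` is a unit, conductor exponent ≤ 2 at the others»; observed directly: L2/L2e 26400/26400, L3 24000/24000 classes).
REF1-AUDIT §180: **SURVIVES** (H10 re-fold: Δ<0 `2^{c0} = #Sel₂` ramified 70 004/70 004 = S38f♮ literally (`𝔠_θ = 𝔮²`), unramified 8 414/8 414; on the
unramified faces single real places DO add characters — L180 is sharp exactly where `e = 1`).  REF2-PLACEMENT v47 §28: **NOT IN PRINT, conjecture-grade with a
THEOREM PATH** = the marked local lemma L₂^mk (a finite 2-adic case analysis per local type of `(E/ℚ₂, F₃ ⊗ ℚ₂)`; method precedents [cite: Kramer1981, Prop. 3],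
Brumer–Kramer 1977 §3 «verify», the descent algorithms of Stoll 2001 / Schaefer–Stoll 2004 — none states a closed-form modulus) + BPT/Kramer bookkeeping at the
other places + Poitou–Tate; nearest print [cite: ChaoLi2018TwoSelmer, Thm. 1.1] (disc `F < 0` squarefree: window of width 1 closed by the root number),
[cite: BarrerasalazarPacettiTornaria2021, Thm. 2.16], [cite: YooYu2022, Thm. 1.10, Thm. 1.11]; grade reading VARIANT-to-new-combination, the delta = the intrinsic
rule at 2 («if L₂^mk is proved for all local types it is a publishable-grade lemma»); -an's recommendation (D-an-127): make L₂^mk + S38n/S38o the cell's lead prover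
target; beyond-print theorem: no.  **LANDING NOTE (-ty g17, 2026-08-29): the marked local lemma is now REFEREED** — -an g21 D-an-139 §24.25 gives L4 = L₂^mk a complete proof sketch in all four
2-types (`MEMO-an-data/g21/an38/THEOREM-PATH-2Selmer.md` bc162793b96e2abd §1b/§1c) and **REF1 §188 = REFEREE PASS on L4** (register l.3449+; evidence `REF1-data/b188/`: the five flagged
points confirmed — level absorption ⟹ `B₂ = U^{(2)}K^{×2}`, `cls_K(ℤ₂^×) ⊆ B₂`, `3 + 2√3 = 1 + 2π`, F7 odd index, `t ≥ 4` model-free; riders R188a–f; independent engine `eng188.py` 8 000 curves,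
1 090 327 point checks, 0 violations; Lean residue certificate `Probe188.lean` 24f465a34f0e1ccb rc 0): **L4 = THEOREM on paper; Theorem A (this row and S38o) + the decider S38q =
PRINT-ASSEMBLY given REF2's pins for L1 (Cassels / BK77 / Schaefer–Stoll) and L2 (Kramer, `c_v` odd)**; REF2 v52 §4: the local CFT facts of §1c are IN PRINT — [cite: Dalawat2010, Prop. 16, Prop. 42, Prop. 60],
JRMS 25 / arXiv:0711.3878, key added by -ty g17), and **L4(e3) IS the -imc THM A** `SupersingularKummerLineCanonicalAtTwo` (`F1Sign2/SupersingularKummerAtlasAtTwo.lean`, p713130: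
`ker N ∩ Ū₅(ℚ₂(∛2)) = {1, ℓ₀}`; REF1 §187; qualitative half in print, Česnavičius Ex. 2-ss-eg) — one lemma, two consumers; beyond-print theorem: still no (planner proof refereed in-cell,
not a kernel theorem); PARTITION unchanged; BSD not proved. -/
@[conjecture] def TwoSelmerIsMarkedTwoDivisionFieldNegDisc : Prop :=
  ∀ (W : WeierstrassCurve ℚ) [W.IsElliptic] [W.IsGloballyMinimal],
    Squarefree (W.conductorNorm ℤ) → Odd W.tamagawaProduct → NoRationalTwoTorsion W → W.Δ < 0 →
    ∀ (F : Type) [Field F] [NumberField F], IsCubicTwoDivisionField W F →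
    ∀ (x₁ : F), (W.baseChange F).twoTorsionPolynomial.toPoly.IsRoot x₁ → ∀ (θ : 𝓞 F), (θ : F) = 4 * x₁ →
      Nat.card (W.selmerGroup 2) = Nat.card (markedQuadraticCharacters F θ ∅)

/-- **S38o `TwoSelmerIsMarkedTwoDivisionFieldPosDisc` (GRAND UNIFIED LAW, `Δ > 0` half; ENGINE H10: 42448/42448 over all seven `Δ > 0`
faces).**  As S38n with `Δ > 0` and the archimedean marking of S38l (`σ₁` = place of the leftmost 2-torsion point):
`2·#M(∅) + #M({σ₂,σ₃}) = #Sel₂(E) + #M({σ₂}) + #M({σ₃})`, `M(S) := markedQuadraticCharacters F θ S`.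
REF1-AUDIT §180: **SURVIVES — and here the inclusion–exclusion form is NECESSARY**: REF1 re-analysis of the H10 rows: the co-marked shortcut `#Sel₂ = #M({σ₂,σ₃})`
fails 2 219/4 000 on the `F₃`-unramified Δ>0 face while this form holds 4 000/4 000 (it counts exactly the norm-square classes; on the ramified faces the two agree,
L180); R180a NEVER-MIDDLE holds on all 42 448 Δ>0 rows (H10 unramified decoded: norm-square line `⟨φ₁⟩` 2 352 rows or `⟨φ₃⟩` 1 655 rows, `⟨φ₂⟩` 0/4 007).
REF2-PLACEMENT v47 §28: NOT IN PRINT (as S38n); the archimedean marking `∞_{σ₂}∞_{σ₃}` IS in print (BPT `P_*(E)` [cite: BarrerasalazarPacettiTornaria2021, Lemma 2.4,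
Def. 2.8]); beyond-print theorem: no. -/
@[conjecture] def TwoSelmerIsMarkedTwoDivisionFieldPosDisc : Prop :=
  ∀ (W : WeierstrassCurve ℚ) [W.IsElliptic] [W.IsGloballyMinimal],
    Squarefree (W.conductorNorm ℤ) → Odd W.tamagawaProduct → NoRationalTwoTorsion W → 0 < W.Δ →
    ∀ (F : Type) [Field F] [NumberField F], IsCubicTwoDivisionField W F →
    ∀ (x₁ : F), (W.baseChange F).twoTorsionPolynomial.toPoly.IsRoot x₁ → ∀ (θ : 𝓞 F), (θ : F) = 4 * x₁ →
    ∀ (σ₁ σ₂ σ₃ : F →+* ℝ), σ₁ ≠ σ₂ → σ₁ ≠ σ₃ → σ₂ ≠ σ₃ → σ₁ x₁ < σ₂ x₁ → σ₁ x₁ < σ₃ x₁ →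
      2 * Nat.card (markedQuadraticCharacters F θ ∅) + Nat.card (markedQuadraticCharacters F θ {σ₂, σ₃})
        = Nat.card (W.selmerGroup 2) + Nat.card (markedQuadraticCharacters F θ {σ₂}) + Nat.card (markedQuadraticCharacters F θ {σ₃})

/-- **S38p `RootNumberFromMarkedTwoDivisionField` (121149/121149): on the whole class the global root number is `(−1)^{dim Sel₂}` with
`dim Sel₂` given by S38n/S38o — a function of the MARKED cubic field alone.** (Monsky 1996 + Cassels give `w = (−1)^{dim Sel₂}` when
`E[2](ℚ) = 0`; the content is the closed form.) Stated: any `k` with `#Sel₂ = 2^k` computed by the law gives `w = (−1)^k`.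
REF1-AUDIT §180: **SURVIVES**; the Δ>0 disjunct hides the marking under `∃ σ₁ σ₂ σ₃` (fine — the witnesses are unique — but the ∃-form makes the prover supply
them; the ∀-forms S38o/S38m are the stronger filings and imply it); 121 149/121 149; out of sample 36 000/36 000 root numbers on random curves `N ≤ 6·10¹²`
(-an R1 j327312).  REF2-PLACEMENT v47 §28: = S38n/S38o + 2-Selmer parity [cite: Monsky1996, Thm. 1.5] [cite: DokchitserDokchitser2010ModSquares, Thm. 1.4] —
COROLLARY of the law, conjecture-grade as filed; content = a closed class-field formula for `w(E)` on the whole odd-local class, a function of the MARKED cubic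
field alone; beyond-print theorem: no. -/
@[conjecture] def RootNumberFromMarkedTwoDivisionField : Prop :=
  ∀ (W : WeierstrassCurve ℚ) [W.IsElliptic] [W.IsGloballyMinimal],
    Squarefree (W.conductorNorm ℤ) → Odd W.tamagawaProduct → NoRationalTwoTorsion W →
    ∀ (F : Type) [Field F] [NumberField F], IsCubicTwoDivisionField W F →
    ∀ (x₁ : F), (W.baseChange F).twoTorsionPolynomial.toPoly.IsRoot x₁ → ∀ (θ : 𝓞 F), (θ : F) = 4 * x₁ →
    ∀ k : ℕ,
      ((W.Δ < 0 ∧ Nat.card (markedQuadraticCharacters F θ ∅) = 2 ^ k) ∨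
       (0 < W.Δ ∧ ∃ (σ₁ σ₂ σ₃ : F →+* ℝ), σ₁ ≠ σ₂ ∧ σ₁ ≠ σ₃ ∧ σ₂ ≠ σ₃ ∧ σ₁ x₁ < σ₂ x₁ ∧ σ₁ x₁ < σ₃ x₁ ∧
          2 * Nat.card (markedQuadraticCharacters F θ ∅) + Nat.card (markedQuadraticCharacters F θ {σ₂, σ₃})
            = 2 ^ k + Nat.card (markedQuadraticCharacters F θ {σ₂}) + Nat.card (markedQuadraticCharacters F θ {σ₃}))) →
      W.rootNumber = (-1) ^ k

/-- **S38q `ShaTwoTrivialIffMarkedCountTwo` — the RANK-1 DESCENT DECIDER on the WHOLE crux class (extends S38i from the ramified faces):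
at analytic rank 1, `Ш(E)[2] = 0 ⟺ the marked count equals 2` (`Δ < 0`: `#M(∅) = 2`).**  Stated for `Δ < 0`; it follows from S38n and
`rank = 1` (GZK) since `#Sel₂ = 2·#Ш[2]` there.
(plain `def`, NOT `@[conjecture]` — the one deliberate deviation from the sketch, REF1 §180 duty (4).)  REF1-AUDIT §180: **SURVIVES but is NOT an obligation —
as TYPED it is S38n rewritten**: the `W.analyticRank = 1` hypothesis is unused decoration (kernel `ANg21.shaTwoDecider_without_analyticRank`, and -an's
`shaTwoDecider_of_grandUnifiedLaw : S38n → this`, Kernel file); the decider CONTENT «`Ш[2] = 0 ⟺ #M(∅) = 2` at analytic rank 1» needs GZK-rank and lives in the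
docstring (as S38i, REF1 §179: S38n + DD parity + GZK + Kummer).  REF2-PLACEMENT v47 §28: S38q (total `Ш[2]`-decider) = S38n + 2-parity + GZK + Kummer, PRINT-ASSEMBLY
given the law; beyond-print theorem: no. -/
def ShaTwoTrivialIffMarkedCountTwoNegDisc : Prop :=
  ∀ (W : WeierstrassCurve ℚ) [W.IsElliptic] [W.IsGloballyMinimal],
    Squarefree (W.conductorNorm ℤ) → Odd W.tamagawaProduct → NoRationalTwoTorsion W → W.Δ < 0 → W.analyticRank = 1 →
    ∀ (F : Type) [Field F] [NumberField F], IsCubicTwoDivisionField W F →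
    ∀ (x₁ : F), (W.baseChange F).twoTorsionPolynomial.toPoly.IsRoot x₁ → ∀ (θ : 𝓞 F), (θ : F) = 4 * x₁ →
      (Nat.card (W.selmerGroup 2) = 2 ↔ Nat.card (markedQuadraticCharacters F θ ∅) = 2)

end GrandUnified

end Summit.BirchSwinnertonDyer.Rank1Residual.F1Sign2.ANg21
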